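import Literature.MathematicalPhysics.QuantumFieldTheory.Balaban1983to89.B3Taylor310Remainder

/-!
# `Balaban1983to89.B3Taylor310LocalRemainder` — T. Bałaban, *(Higgs)₂,₃ quantum fields in a finite volume. III. Renormalization*,
Commun. Math. Phys. **88** (1983) 411–445 [Balaban1983Higgs3], pp. 435–436 [PDF 25–26]: the remainder of Taylor's formula (3.10) along the
contour `Γ_{x,x′}` under a LOCAL bound on the oscillation of the derivative of the leg — the *"last supremum in (3.13)"*,
`sup_{y∈Γ_{x,x′},μ}|(∂^η_μφ′)(y) − (∂^η_μφ′)(x)|`, taken ALONG THE CONTOUR ONLY (p20 g2's `B3Taylor310Remainder.norm_remFwd_le` used a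
global Hölder constant); plus the metric properties of the `ℓ¹` torus distance this needs

statement-level skeleton of published theorems with citation tags; proofs where landed; nothing here is a claim about the Yang–Mills mass gap

PDF held: `paper:balaban1983-higgs-2-3-quantum-fields-finite-volume` (journal page = PDF page + 410); pp. 435–436 read on the ×4 renders
`run/shared/lean/pub/pub-balaban/b2b-balaban-ref1/pages/1983-cmp88-higgs23-III/1983-cmp88-higgs23-III-p025/p026-x4.png`.

CITATION HEADER (lean-in-tree rule).  Part of the lit-balaban TYPED SKELETON (HOME `run/shared/lean/pub/lit-balaban/`), PHASE 2, seat p20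
generation 4; companion of `B3Ineq314Local` (same seat: the (3.14) step, which consumes `norm_remFwd_le_local`).  WHAT IS REPRODUCED: rows
**B3.Eq3.10** / **B3.Eq3.11-3.17** of `HOME/lit-balaban-r15/ROWS-B3.md` (fold owner r15).  Inputs: p20 g2's `B3Taylor310Remainder` (p248129:
`steps`, `remUp`, `remDown`, `rem`, `corr`, `remFwd`, the path geometry `tdist_runSite_mixSite_le`/`tdist_downSite_mixSite_le`,
`pdiffAdj_eq_neg_pdiff_unshift`, `sum_steps_eq_tdist`).

THE PRINTED TEXT (verbatim, p. 436).  (3.13) ends in the factor *"(L^{j₁}η)^{1+α} sup_{x∈Δ(v),x′∈Δ(v′)} sup_{y∈Γ_{x,x′},μ}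
|(∂^η_μφ′)(y) − (∂^η_μφ′)(x)| / |y − x|^α"* — the Hölder quotient of the leg is needed only for the sites `y` of the contour `Γ_{x,x′}`;
p. 435: *"Σ_{b⊂Γ_{x,x′}} η|b_− − x|^α ((∂^ηφ′)(b) − (∂^ηφ′)((b)_x))/|b_− − x|^α"* (the remainder of (3.10)).

WHAT IS PROVED, and how.  `tdist_triangle` (the `ℓ¹` torus distance `Site.tdist` is a metric: `ZMod.natAbs_valMinAbs_add_le`
coordinatewise), `tdist_comm`, `tdist_self`, `tdist_unshift_le_one`; **`norm_remFwd_le_local`**: if the lattice derivative of the leg `f` has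
two-point oscillation `‖(∂^η_μf)(z) − (∂^η_μf)(z′)‖ ≤ K` for all `z, z′` in the `ℓ¹`-ball of radius `R ≥ |x − y|₁ + 1` about `x` (this ball
contains every site of `Γ_{x,y}` — p20 g2's `tdist_runSite_mixSite_le`, `tdist_downSite_mixSite_le` — and its backward neighbours, where
the backward differences `∂^{η*}` of the negatively traversed runs live), then `‖remFwd(x,y)‖ ≤ 2K·η|x − y|₁` (`norm_remUp_le_local`,
`norm_remDown_le_local`: one `η·K` per bond; the orientation correction `corr` contributes second differences at `x`, again `≤ η·K` each).
D-0026: theorems only, no `def`, no named fact; standard axioms.  Unit `lit-balaban-p20` (literature-prover-lit-balaban-p20-g4-0), 2026-08-21.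
-/

open scoped BigOperators

namespace Literature.MathematicalPhysics.QuantumFieldTheory.Balaban1983to89.B3Taylor310LocalRemainder

open LatticeFieldCalculus B3Taylor310Remainder

noncomputable section

/-! ## 0. The ℓ¹ torus distance is a metric -/

section Torus

variable {P : Params} {j : ℕ}

/-- kernel: the least-absolute-value residue measures the torus distance of one coordinate. [folklore] -/
private theorem natAbs_valMinAbs_eq_min {n : ℕ} [NeZero n] (a : ZMod n) : a.valMinAbs.natAbs = min a.val (-a).val := by
  rw [ZMod.valMinAbs_natAbs_eq_min, ZMod.neg_val]
  split_ifs with h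
  · subst h; simp
  · rfl

/-- The `ℓ¹` torus distance as a sum of least-absolute-value residues: `|x − y|₁ = Σ_μ |(x_μ − y_μ)~|`. [cite: Balaban1983Higgs3, (3.10) p.435] -/
theorem tdist_eq_sum_natAbs (x y : Site P j) : Site.tdist x y = ∑ μ : Fin P.d, ((x μ - y μ).valMinAbs).natAbs := by
  unfold Site.tdist
  exact Finset.sum_congr rfl fun μ _ => by rw [natAbs_valMinAbs_eq_min, neg_sub]

/-- The `ℓ¹` torus distance is symmetric. [cite: Balaban1983Higgs3, (3.10) p.435] -/
theorem tdist_comm (x y : Site P j) : Site.tdist x y = Site.tdist y x := by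
  simp only [Site.tdist, min_comm]

/-- The `ℓ¹` torus distance vanishes on the diagonal. [cite: Balaban1983Higgs3, (3.10) p.435] -/
theorem tdist_self (x : Site P j) : Site.tdist x x = 0 := by
  simp [Site.tdist]

/-- **Triangle inequality** for the `ℓ¹` torus distance: `|x − z|₁ ≤ |x − y|₁ + |y − z|₁` (coordinatewise, the distance on `ℤ/N` is a
metric: `ZMod.natAbs_valMinAbs_add_le`). [cite: Balaban1983Higgs3, (3.10) p.435] -/
theorem tdist_triangle (x y z : Site P j) : Site.tdist x z ≤ Site.tdist x y + Site.tdist y z := by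
  rw [tdist_eq_sum_natAbs, tdist_eq_sum_natAbs, tdist_eq_sum_natAbs, ← Finset.sum_add_distrib]
  refine Finset.sum_le_sum fun μ _ => ?_
  have h : x μ - z μ = (x μ - y μ) + (y μ - z μ) := by ring
  rw [h]
  exact (ZMod.natAbs_valMinAbs_add_le _ _).trans (Int.natAbs_add_le _ _)

/-- kernel: `(t : ZMod n).val ≤ t`. [folklore] -/
private theorem val_natCast_le {n : ℕ} [NeZero n] (t : ℕ) : ((t : ZMod n)).val ≤ t := by
  rw [ZMod.val_natCast]; exact Nat.mod_le _ _

/-- Nearest neighbours are at `ℓ¹` torus distance at most one: `|(z − e_μ) − z|₁ ≤ 1`. [cite: Balaban1983Higgs3, (3.10) p.435] -/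
theorem tdist_unshift_le_one (z : Site P j) (μ : Fin P.d) : Site.tdist (z.unshift μ) z ≤ 1 := by
  unfold Site.tdist
  have h1 : ∀ ν : Fin P.d, min (z.unshift μ ν - z ν).val (z ν - z.unshift μ ν).val ≤ if ν = μ then 1 else 0 := by
    intro ν
    by_cases h : ν = μ
    · subst h
      simp only [Site.unshift, Function.update_self, sub_sub_cancel, if_true]
      calc min (z ν - 1 - z ν).val (1 : ZMod (P.sitesPerDir j)).val ≤ (1 : ZMod (P.sitesPerDir j)).val := min_le_right _ _
        _ = ((1 : ℕ) : ZMod (P.sitesPerDir j)).val := by rw [Nat.cast_one]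
        _ ≤ 1 := val_natCast_le 1
    · simp [Site.unshift, h]
  calc ∑ ν : Fin P.d, min (z.unshift μ ν - z ν).val (z ν - z.unshift μ ν).val
      ≤ ∑ ν : Fin P.d, (if ν = μ then 1 else 0) := Finset.sum_le_sum fun ν _ => h1 ν
    _ = 1 := by simp

end Torus

/-! ## 1. The remainder of (3.10) under a LOCAL oscillation bound on the derivative of the leg -/

section LocalRemainder

variable {P : Params} {j : ℕ} {V : Type*} [NormedAddCommGroup V] [NormedSpace ℝ V]

/-- The remainder on a positive run under the local bound: at most `n⁺_μ·η·K`. [cite: Balaban1983Higgs3, (3.13) p.436] -/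
theorem norm_remUp_le_local {c K : ℝ} (hc : 0 < c) {f : SiteField P j V} {x y : Site P j} {R : ℕ} (hR : Site.tdist x y + 1 ≤ R)
    (hf : ∀ (μ : Fin P.d) (z z' : Site P j), Site.tdist z x ≤ R → Site.tdist z' x ≤ R → ‖pdiff c μ f z - pdiff c μ f z'‖ ≤ K)
    (μ : Fin P.d) :
    ‖remUp c f x y μ‖ ≤ ((steps x y μ).toNat : ℝ) * (c⁻¹ * K) := by
  unfold remUp
  have hterm : ∀ t ∈ Finset.range (steps x y μ).toNat,
      ‖c⁻¹ • (pdiff c μ f (runSite (mixSite μ x y) μ t) - pdiff c μ f x)‖ ≤ c⁻¹ * K := by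
    intro t ht
    rw [norm_smul, Real.norm_of_nonneg (inv_nonneg.mpr hc.le)]
    refine mul_le_mul_of_nonneg_left (hf μ _ x ?_ (by rw [tdist_self]; exact Nat.zero_le _)) (inv_nonneg.mpr hc.le)
    refine (tdist_runSite_mixSite_le x y μ ?_).trans (by omega)
    have h1 : t < (steps x y μ).toNat := Finset.mem_range.mp ht
    have h2 : (steps x y μ).toNat ≤ (steps x y μ).natAbs := by
      rw [← Int.toNat_add_toNat_neg_eq_natAbs]; exact Nat.le_add_right _ _
    omega
  calc ‖∑ t ∈ Finset.range (steps x y μ).toNat, c⁻¹ • (pdiff c μ f (runSite (mixSite μ x y) μ t) - pdiff c μ f x)‖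
      ≤ ∑ t ∈ Finset.range (steps x y μ).toNat, ‖c⁻¹ • (pdiff c μ f (runSite (mixSite μ x y) μ t) - pdiff c μ f x)‖ :=
        norm_sum_le _ _
    _ ≤ ∑ t ∈ Finset.range (steps x y μ).toNat, c⁻¹ * K := Finset.sum_le_sum hterm
    _ = ((steps x y μ).toNat : ℝ) * (c⁻¹ * K) := by rw [Finset.sum_const, Finset.card_range, nsmul_eq_mul]

/-- The remainder on a negative run under the local bound: at most `n⁻_μ·η·K` (backward differences are forward differences one step back;
the shifted sites stay in the ball of radius `|x − y|₁ + 1`). [cite: Balaban1983Higgs3, (3.13) p.436] -/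
theorem norm_remDown_le_local {c K : ℝ} (hc : 0 < c) {f : SiteField P j V} {x y : Site P j} {R : ℕ} (hR : Site.tdist x y + 1 ≤ R)
    (hf : ∀ (μ : Fin P.d) (z z' : Site P j), Site.tdist z x ≤ R → Site.tdist z' x ≤ R → ‖pdiff c μ f z - pdiff c μ f z'‖ ≤ K)
    (μ : Fin P.d) :
    ‖remDown c f x y μ‖ ≤ ((-steps x y μ).toNat : ℝ) * (c⁻¹ * K) := by
  unfold remDown
  have hxu : Site.tdist (x.unshift μ) x ≤ R := (tdist_unshift_le_one x μ).trans (by omega)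
  have hterm : ∀ t ∈ Finset.range (-steps x y μ).toNat,
      ‖c⁻¹ • (pdiffAdj c μ f (Function.update (mixSite μ x y) μ (x μ - (t : ZMod (P.sitesPerDir j)))) - pdiffAdj c μ f x)‖
        ≤ c⁻¹ * K := by
    intro t ht
    rw [norm_smul, Real.norm_of_nonneg (inv_nonneg.mpr hc.le)]
    refine mul_le_mul_of_nonneg_left ?_ (inv_nonneg.mpr hc.le)
    rw [pdiffAdj_eq_neg_pdiff_unshift, pdiffAdj_eq_neg_pdiff_unshift, neg_sub_neg]
    refine hf μ _ _ hxu ?_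
    set z' : Site P j := Function.update (mixSite μ x y) μ (x μ - (t : ZMod (P.sitesPerDir j))) with hz'
    have hz'x : Site.tdist z' x ≤ Site.tdist x y := by
      refine tdist_downSite_mixSite_le x y μ ?_
      have h1 : t < (-steps x y μ).toNat := Finset.mem_range.mp ht
      have h2 : (-steps x y μ).toNat ≤ (steps x y μ).natAbs := by
        rw [← Int.toNat_add_toNat_neg_eq_natAbs]; exact Nat.le_add_left _ _
      omega
    calc Site.tdist (z'.unshift μ) x ≤ Site.tdist (z'.unshift μ) z' + Site.tdist z' x := tdist_triangle _ _ _
      _ ≤ 1 + Site.tdist x y := add_le_add (tdist_unshift_le_one z' μ) hz'x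
      _ ≤ R := by omega
  calc ‖∑ t ∈ Finset.range (-steps x y μ).toNat,
          c⁻¹ • (pdiffAdj c μ f (Function.update (mixSite μ x y) μ (x μ - (t : ZMod (P.sitesPerDir j)))) - pdiffAdj c μ f x)‖
      ≤ ∑ t ∈ Finset.range (-steps x y μ).toNat,
          ‖c⁻¹ • (pdiffAdj c μ f (Function.update (mixSite μ x y) μ (x μ - (t : ZMod (P.sitesPerDir j)))) - pdiffAdj c μ f x)‖ :=
        norm_sum_le _ _
    _ ≤ ∑ t ∈ Finset.range (-steps x y μ).toNat, c⁻¹ * K := Finset.sum_le_sum hterm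
    _ = ((-steps x y μ).toNat : ℝ) * (c⁻¹ * K) := by rw [Finset.sum_const, Finset.card_range, nsmul_eq_mul]

/-- **The LOCAL remainder bound** — the *"last supremum in (3.13)"* taken along the contour only: if the lattice derivative of the leg has
two-point oscillation at most `K` on the `ℓ¹`-ball of radius `R ≥ |x − y|₁ + 1` about `x` (it contains the sites of `Γ_{x,y}` and their
backward neighbours), then `‖remFwd(x,y)‖ ≤ 2K·η|x − y|₁` (`η = c⁻¹`; the remainder part and the orientation correction contribute
`K·η|x − y|₁` each). [cite: Balaban1983Higgs3, (3.13) p.436] -/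
theorem norm_remFwd_le_local {c K : ℝ} (hc : 0 < c) (hK : 0 ≤ K) {f : SiteField P j V} {x y : Site P j} {R : ℕ}
    (hR : Site.tdist x y + 1 ≤ R)
    (hf : ∀ (μ : Fin P.d) (z z' : Site P j), Site.tdist z x ≤ R → Site.tdist z' x ≤ R → ‖pdiff c μ f z - pdiff c μ f z'‖ ≤ K) :
    ‖remFwd c f x y‖ ≤ 2 * K * (c⁻¹ * (Site.tdist x y : ℝ)) := by
  have hcK : 0 ≤ c⁻¹ * K := mul_nonneg (inv_nonneg.mpr hc.le) hK
  -- the remainder proper: one `η·K` per bond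
  have hrem : ‖rem c f x y‖ ≤ (Site.tdist x y : ℝ) * (c⁻¹ * K) := by
    unfold rem
    calc ‖∑ μ : Fin P.d, (remUp c f x y μ + remDown c f x y μ)‖
        ≤ ∑ μ : Fin P.d, ‖remUp c f x y μ + remDown c f x y μ‖ := norm_sum_le _ _
      _ ≤ ∑ μ : Fin P.d, ((((steps x y μ).toNat : ℕ) : ℝ) * (c⁻¹ * K) + (((-steps x y μ).toNat : ℕ) : ℝ) * (c⁻¹ * K)) :=
          Finset.sum_le_sum fun μ _ => (norm_add_le _ _).trans
            (add_le_add (norm_remUp_le_local hc hR hf μ) (norm_remDown_le_local hc hR hf μ))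
      _ = (∑ μ : Fin P.d, (((steps x y μ).toNat + (-steps x y μ).toNat : ℕ) : ℝ)) * (c⁻¹ * K) := by
          rw [Finset.sum_mul]
          exact Finset.sum_congr rfl fun μ _ => by push_cast; ring
      _ = (Site.tdist x y : ℝ) * (c⁻¹ * K) := by rw [← sum_steps_eq_tdist x y]; push_cast; rfl
  -- the orientation correction: second differences at `x`, i.e. `∂f(x) − ∂f(x − e_μ)`, `n⁻_μ` times
  have hcorr : ‖corr c f x y‖ ≤ (Site.tdist x y : ℝ) * (c⁻¹ * K) := by
    unfold corr
    have hterm : ∀ μ : Fin P.d,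
        ‖(((-steps x y μ).toNat : ℕ) : ℝ) • c⁻¹ • (pdiffAdj c μ f x + pdiff c μ f x)‖ ≤ (((-steps x y μ).toNat : ℕ) : ℝ) * (c⁻¹ * K) := by
      intro μ
      rw [norm_smul, norm_smul, Real.norm_of_nonneg (Nat.cast_nonneg _), Real.norm_of_nonneg (inv_nonneg.mpr hc.le)]
      refine mul_le_mul_of_nonneg_left (mul_le_mul_of_nonneg_left ?_ (inv_nonneg.mpr hc.le)) (Nat.cast_nonneg _)
      rw [pdiffAdj_eq_neg_pdiff_unshift, neg_add_eq_sub]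
      exact hf μ x (x.unshift μ) (by rw [tdist_self]; exact Nat.zero_le _) ((tdist_unshift_le_one x μ).trans (by omega))
    calc ‖∑ μ : Fin P.d, (((-steps x y μ).toNat : ℕ) : ℝ) • c⁻¹ • (pdiffAdj c μ f x + pdiff c μ f x)‖
        ≤ ∑ μ : Fin P.d, ‖(((-steps x y μ).toNat : ℕ) : ℝ) • c⁻¹ • (pdiffAdj c μ f x + pdiff c μ f x)‖ := norm_sum_le _ _
      _ ≤ ∑ μ : Fin P.d, (((-steps x y μ).toNat : ℕ) : ℝ) * (c⁻¹ * K) := Finset.sum_le_sum fun μ _ => hterm μ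
      _ ≤ ∑ μ : Fin P.d, (((steps x y μ).toNat + (-steps x y μ).toNat : ℕ) : ℝ) * (c⁻¹ * K) :=
          Finset.sum_le_sum fun μ _ => mul_le_mul_of_nonneg_right (by exact_mod_cast Nat.le_add_left _ _) hcK
      _ = (Site.tdist x y : ℝ) * (c⁻¹ * K) := by rw [← Finset.sum_mul, ← sum_steps_eq_tdist x y]; push_cast; rfl
  unfold remFwd
  calc ‖rem c f x y + corr c f x y‖ ≤ ‖rem c f x y‖ + ‖corr c f x y‖ := norm_add_le _ _
    _ ≤ (Site.tdist x y : ℝ) * (c⁻¹ * K) + (Site.tdist x y : ℝ) * (c⁻¹ * K) := add_le_add hrem hcorr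
    _ = 2 * K * (c⁻¹ * (Site.tdist x y : ℝ)) := by ring

end LocalRemainder

end

end Literature.MathematicalPhysics.QuantumFieldTheory.Balaban1983to89.B3Taylor310LocalRemainder
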